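import Summits.BirchSwinnertonDyer.BirchSwinnertonDyer.Theorems.ByReductionTypeAtTwoRankOneAtTwoBigImageOddLocalOneDoorSubsliceFirstLayerManinFree
import Summits.BirchSwinnertonDyer.BirchSwinnertonDyer.Theorems.ByReductionTypeAtTwoRankOneAtTwoBigImageOddLocalOneDoorSubsliceNegDiscTwoConverse
import HarnessLib

/-!
# Route ByReductionTypeAtTwo, crux `RankOneAtTwoBigImageOddLocal` (stmt-BirchSwinnertonDyer-23715), LINE v8.17 `one_door_analytic` (final form):
# THE MANIN-FREE SPLIT IS LOSSLESS — crux ⟺ R₀⁺ ∧ R_S ∧ R_N modulo PRINT⁴ + rank-`0` cruxes + the rank-`0` `2`-converse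

Lead prover seat `bsd-line-fkl-p1` g16 (2026-08-28), `--supports stmt-BirchSwinnertonDyer-23715` (helper).  THEOREMS ONLY; no definition, no named fact
introduced, no `sorry`; conditional by design.  BSD is not proved by any of this.  Sequel of `Theorems/…OneDoorSubsliceFirstLayerManinFree.lean` (the v8.17
composition), kept in a separate module because the rank-`0` `2`-converse is read in route TwoAdicConverse's currency (`selmerCorank`, via the width seat's
`…OneDoorSubsliceNegDiscTwoConverse.lean`, which imports that route's thesis file) — the composition file and the crux skeleton stay out of that import cone.

* `exponent_padicVal_of_bsdp_two_at_minimalDoor` — `BSDp W 2` ⟹ exponent `v₂(c)` at any `Sel₂`-trivial minimal door whose twin is known (per-datum kernel iff: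
  `2m + [Δ_W<0] = 0 + 0 + (t + 2s) + 2·v₂(c)` with `t + 2s = [Δ_W<0]`), either sign, any datum;
* `heegnerExponent_of_bsdTwo_on_locus_of_twoConverse`, **`heegnerExponent_of_rankOneAtTwoBigImageOddLocal_of_twoConverse`** — R₀⁺ FROM THE CRUX modulo the
  reduction-type-free rank-`0` `2`-converse `hconv : ¬CM → corank_{ℤ₂} Sel_{2^∞}(V) = 0 → r_an(V) = 0` (OPEN; nothing asserted) and the four rank-`0` cruxes;
* `residueSha_and_residueNonEgg_of_rankOneAtTwoBigImageOddLocal` — R_S ∧ R_N FROM THE CRUX modulo PRINT⁴ + rank-`0` only.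
With `rankOneAtTwoBigImageOddLocal_of_heegnerExponent_of_residueSha_of_residueNonEgg`: crux ⟺ R₀⁺ ∧ R_S ∧ R_N modulo those inputs (the width seat fkl-p2 g14's
sign-split table `rankOneAtTwoBigImageOddLocal_iff_floats_sha_nonEgg_of_twoConverse` is the same statement through its bridge `heegnerExponentMinimalDoor_iff_floats`).

References: [Zhang2014CJM] Thm. 1.1 (shape); [GrossZagier1986] Thm. I.6.3, V.§2; [GrossLMS1991] Conj. 1.2, §3, §10; [BhargavaSkinnerZhang2014] Thm. 5 (d);
[MazurRubin2010] Cor. 3.4 (i); [Kramer1981] Prop. 6.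
-/

set_option autoImplicit false
-- the Theorems namespace of this sub repeats the summit name by design (D-0017 nested layout)
set_option linter.dupNamespace false

noncomputable section

open scoped Classical

namespace Summit.BirchSwinnertonDyer.BirchSwinnertonDyer.Theorems.RankOneAtTwoOneDoor

open WeierstrassCurve NumberField Literature.NumberTheory.EllipticCurves Literature.NumberTheory.EllipticCurves.ModularForms
  Summit.BirchSwinnertonDyer.Rank1Residual.F1Sign2
  Summit.BirchSwinnertonDyer.Rank1Residual.F1Sign2.TranspositionDoor
  Summit.BirchSwinnertonDyer.BirchSwinnertonDyer.Theses.ByReductionTypeAtTwo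

/-! ### Losslessness modulo the rank-`0` `2`-converse -/

/-- **`BSDp W 2 ⟹` EXPONENT `v₂(c)` AT ANY `Sel₂`-TRIVIAL MINIMAL DOOR WHOSE TWIN IS KNOWN** (either sign, any datum): the per-datum kernel iff
(`bsdp_two_iff_doorLawFullC_at_of_rank`) gives `m` with `2m + [Δ_W<0] = s_W + s_d + t + 2s + 2·v₂(c)`; `s_W = s_d = 0`, `t + 2s = [Δ_W<0]`; so `m = v₂(c)`.  The
floating-exponent form of `hasTwoDivisibilityUpToTorsion_zero_of_bsdp_two_at_minimalDoor`.  CONDITIONAL by design (Gross–Zagier, Kolyvagin, modularity,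
Hoffstein–Luo, `BSDp W 2`, the door's non-vanishing and `BSDp Wd 2` as hypotheses); BSD is not proved by this. [cite: Zhang2014CJM, Thm. 1.1]
[cite: GrossZagier1986, Thm. I.6.3 and V.§2] [cite: GrossLMS1991, Conj. 1.2 and §3] -/
theorem exponent_padicVal_of_bsdp_two_at_minimalDoor
    (hGZ : ∀ (N : ℕ) [NeZero N] (W : WeierstrassCurve ℚ) (K : Type) [Field K] [NumberField K], gross_zagier N W K)
    (hKo : ∀ (N : ℕ) [NeZero N] (W : WeierstrassCurve ℚ) (K : Type) [Field K] [NumberField K], kolyvagin N W K)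
    (hnf : exists_isNewformOf) (hHL : HoffsteinLuo1997_exists_twist_L_one_ne_zero)
    (W : WeierstrassCurve ℚ) [W.IsElliptic] [W.IsGloballyMinimal] [NeZero (W.conductorNorm ℤ)]
    (hT : Odd W.torsionOrder) (hc : Odd W.tamagawaProduct) (hr : W.analyticRank = 1) (hSha : ShaTwoTrivial W) (hB : BSDp W 2)
    (K : Type) [Field K] [NumberField K] (hK : IsImaginaryQuadratic K) (hadm : DoorAdmissible W (NumberField.discr K))
    (hmin : transpCount W (NumberField.discr K) + 2 * identCount W (NumberField.discr K) = (if W.Δ < 0 then 1 else 0))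
    (hsel : twistSelmerTwoCard W (NumberField.discr K) = 1)
    (hLt : (W.quadraticTwist (NumberField.discr K : ℚ)).entireLFunction 1 ≠ 0)
    (Dt : ModularParametrizationData W (W.conductorNorm ℤ)) (H : HeegnerDatum (W.conductorNorm ℤ) (NumberField.discr K))
    (ι : K →+* ℂ) (P : (W.baseChange K).toAffine.Point)
    (hP : WeierstrassCurve.Affine.Point.map ι.toRatAlgHom P = heegnerPointComplex Dt H)
    (Wd : WeierstrassCurve ℚ) [Wd.IsElliptic] [Wd.IsGloballyMinimal] (Cd : WeierstrassCurve.VariableChange ℚ)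
    (hWd : Cd • W.quadraticTwist (NumberField.discr K : ℚ) = Wd) (hBd : BSDp Wd 2) :
    HasTwoDivisibilityUpToTorsion W K P (padicValInt 2 Dt.c) := by
  haveI : Fact (Nat.Prime 2) := ⟨Nat.prime_two⟩
  have hmod : hasEntireLFunction_rat := hasEntireLFunction_rat_of_exists_isNewformOf hnf
  have hrk : W.mordellWeilRank = 1 :=
    (mordellWeilRank_eq_one_of_analyticRank_eq_one_of_isGloballyMinimal hGZ hKo hnf hHL W hr).1
  have hHN : SatisfiesHeegnerHypothesis (W.conductorNorm ℤ) K := satisfiesHeegnerHypothesis_of_doorAdmissible W K hK hadm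
  obtain ⟨-, -, hiff⟩ :=
    bsdp_two_iff_doorLawFullC_at_of_rank hmod doorTwistTamagawaAtTwo W hT hc hr hrk K hK (hGZ _ W K) (hKo _ W K) hadm hHN hLt
      Dt H ι P hP Wd Cd hWd hBd
  obtain ⟨m, hm, hlaw⟩ := hiff.mp hB
  have hsW : padicValNat 2 (Nat.card (AddCommGroup.primaryComponent W.sha 2)) = 0 :=
    padicValNat_card_primaryComponent_sha_two_eq_zero_of_shaTwoTrivial W hSha
  have hD0 : (NumberField.discr K : ℚ) ≠ 0 := by exact_mod_cast NumberField.discr_ne_zero K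
  obtain ⟨-, -, hbotd⟩ := twist_arith_of_selmerTrivial W hD0 hsel Wd Cd hWd
  have hsd : padicValNat 2 (Nat.card (AddCommGroup.primaryComponent Wd.sha 2)) = 0 := by
    rw [hbotd, AddSubgroup.card_bot]; simp
  rw [hsW, hsd] at hlaw
  have hmv : m = padicValInt 2 Dt.c := by
    by_cases hΔ : W.Δ < 0
    · rw [if_pos hΔ] at hlaw hmin; omega
    · rw [if_neg hΔ] at hlaw hmin; omega
  subst hmv
  exact hm

/-- **R₀⁺ FROM `BSD₂` ON THE FIRST-LAYER LOCUS (hence FROM THE CRUX)**, modulo the four primary printed facts, the route's four rank-`0` cruxes at `2` BY NAME and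
the reduction-type-free rank-`0` `2`-converse `hconv` (OPEN at `2`; nothing asserted): at a `Sel₂`-trivial minimal door the twin (a globally minimal model, non-CM by
`j`-invariance) has corank `0` (`twin_selmerCorank_two_eq_zero_of_twistSelmerTwoCard_eq_one`), hence (`hconv`) analytic rank `0`: the door is open
(`analyticRank_eq_zero_iff`, `entireLFunction_smul`) and `BSDp Wd 2` holds (`bsdp_two_of_rankZero_cruxes`); then the previous theorem.  CONDITIONAL by design;
BSD is not proved by this. [cite: Zhang2014CJM, Thm. 1.1] [cite: GrossZagier1986, Thm. I.6.3 and V.§2] [cite: BhargavaSkinnerZhang2014, Thm. 5 (d)] -/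
theorem heegnerExponent_of_bsdTwo_on_locus_of_twoConverse
    (hGZ : ∀ (N : ℕ) [NeZero N] (W : WeierstrassCurve ℚ) (K : Type) [Field K] [NumberField K], gross_zagier N W K)
    (hKo : ∀ (N : ℕ) [NeZero N] (W : WeierstrassCurve ℚ) (K : Type) [Field K] [NumberField K], kolyvagin N W K)
    (hnf : exists_isNewformOf) (hHL : HoffsteinLuo1997_exists_twist_L_one_ne_zero)
    (hZ4 : GoodOrdinaryRankZeroAtTwo ∧ MultiplicativeRankZeroAtTwo ∧ SupersingularRankZeroAtTwo ∧ AdditiveRankZeroAtTwo)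
    (hconv : ∀ (V : WeierstrassCurve ℚ) [V.IsElliptic] [V.IsGloballyMinimal], ¬ V.HasCM → V.selmerCorank 2 = 0 → V.analyticRank = 0)
    (hBcls : ∀ (W : WeierstrassCurve ℚ) [W.IsElliptic] [W.IsGloballyMinimal] [NeZero (W.conductorNorm ℤ)],
      ¬ W.HasCM → (∀ n : ℕ, W.HasSurjectiveModNGaloisRep ((2 ^ n : ℕ) : ℤ)) → Odd W.torsionOrder → Odd W.tamagawaProduct →
      W.analyticRank = 1 → ShaTwoTrivial W → BSDp W 2) :
    HeegnerExponentAtSelmerTrivialMinimalDoorAtTwo := by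
  intro W _ _ _ hCM hsurj hT hc hr hSha K _ _ hK hadm hmin _hcop _hHN hsel Dt H ι P hP
  have hB : BSDp W 2 := hBcls W hCM hsurj hT hc hr hSha
  have hmod : hasEntireLFunction_rat := hasEntireLFunction_rat_of_exists_isNewformOf hnf
  have hD0 : (NumberField.discr K : ℚ) ≠ 0 := by exact_mod_cast NumberField.discr_ne_zero K
  haveI hEt : (W.quadraticTwist (NumberField.discr K : ℚ)).IsElliptic := W.isElliptic_quadraticTwist hD0
  obtain ⟨Cd, hCd⟩ := hasGlobalMinimalModel_rat_holds (W.quadraticTwist (NumberField.discr K : ℚ))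
  haveI := hCd
  set Wd : WeierstrassCurve ℚ := Cd • W.quadraticTwist (NumberField.discr K : ℚ) with hWd_def
  have hWd : Cd • W.quadraticTwist (NumberField.discr K : ℚ) = Wd := rfl
  have hCMd : ¬ Wd.HasCM := RamifiedPairUpperBound.not_hasCM_of_smul_quadraticTwist_eq hD0 hWd hCM
  have hrd : Wd.analyticRank = 0 := hconv Wd hCMd (twin_selmerCorank_two_eq_zero_of_twistSelmerTwoCard_eq_one W hsel Wd Cd hWd)
  have hLeq : Wd.entireLFunction = (W.quadraticTwist (NumberField.discr K : ℚ)).entireLFunction := by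
    rw [← hWd, entireLFunction_smul]
  have hLt : (W.quadraticTwist (NumberField.discr K : ℚ)).entireLFunction 1 ≠ 0 := by
    rw [← hLeq]
    exact (Wd.analyticRank_eq_zero_iff_holds (hmod Wd)).1 hrd
  have hBd : BSDp Wd 2 := bsdp_two_of_rankZero_cruxes hZ4 Wd hCMd hrd
  exact exponent_padicVal_of_bsdp_two_at_minimalDoor hGZ hKo hnf hHL W hT hc hr hSha hB K hK hadm hmin hsel hLt Dt H ι P hP Wd Cd hWd hBd

/-- **R₀⁺ FROM THE CRUX** (modulo PRINT⁴, the four rank-`0` cruxes BY NAME, and the rank-`0` `2`-converse `hconv`): the crux gives `BSDp W 2` on the slice.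
So the v8.17 stub R₀⁺ is the crux's own content on the first-layer locus, up to `hconv`.  CONDITIONAL by design; BSD is not proved by this.
[cite: Zhang2014CJM, Thm. 1.1] [cite: GrossLMS1991, Conj. 1.2 and §10] -/
theorem heegnerExponent_of_rankOneAtTwoBigImageOddLocal_of_twoConverse
    (hGZ : ∀ (N : ℕ) [NeZero N] (W : WeierstrassCurve ℚ) (K : Type) [Field K] [NumberField K], gross_zagier N W K)
    (hKo : ∀ (N : ℕ) [NeZero N] (W : WeierstrassCurve ℚ) (K : Type) [Field K] [NumberField K], kolyvagin N W K)
    (hnf : exists_isNewformOf) (hHL : HoffsteinLuo1997_exists_twist_L_one_ne_zero)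
    (hZ4 : GoodOrdinaryRankZeroAtTwo ∧ MultiplicativeRankZeroAtTwo ∧ SupersingularRankZeroAtTwo ∧ AdditiveRankZeroAtTwo)
    (hconv : ∀ (V : WeierstrassCurve ℚ) [V.IsElliptic] [V.IsGloballyMinimal], ¬ V.HasCM → V.selmerCorank 2 = 0 → V.analyticRank = 0)
    (hX : RankOneAtTwoBigImageOddLocal) : HeegnerExponentAtSelmerTrivialMinimalDoorAtTwo :=
  heegnerExponent_of_bsdTwo_on_locus_of_twoConverse hGZ hKo hnf hHL hZ4 hconv (fun W _ _ _ hCM hsurj hT hc hr _ => hX W hCM hsurj hT hc hr)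

/-- **R_S ∧ R_N FROM THE CRUX** (modulo PRINT⁴ and the four rank-`0` cruxes only — no `2`-converse): the crux gives the hypothesis-free form
`DoorIndexLawFullCAtTwoSomeDoor` (`doorIndexLawFullCAtTwoSomeDoor_of_rankOneAtTwoBigImageOddLocal`, lead g15), of which R_S and R_N are restrictions
(`residueSha_and_residueNonEgg_of_someDoor`).  With `rankOneAtTwoBigImageOddLocal_of_heegnerExponent_of_residueSha_of_residueNonEgg` and the previous theorem:
crux ⟺ R₀⁺ ∧ R_S ∧ R_N modulo PRINT⁴ + rank-`0` cruxes + the rank-`0` `2`-converse — v8.17 is LOSSLESS.  CONDITIONAL by design; BSD is not proved by this.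
[cite: GrossLMS1991, Conj. 1.2, §3 and §10] [cite: Zhang2014CJM, Thm. 1.1] -/
theorem residueSha_and_residueNonEgg_of_rankOneAtTwoBigImageOddLocal
    (hGZ : ∀ (N : ℕ) [NeZero N] (W : WeierstrassCurve ℚ) (K : Type) [Field K] [NumberField K], gross_zagier N W K)
    (hKo : ∀ (N : ℕ) [NeZero N] (W : WeierstrassCurve ℚ) (K : Type) [Field K] [NumberField K], kolyvagin N W K)
    (hnf : exists_isNewformOf) (hHL : HoffsteinLuo1997_exists_twist_L_one_ne_zero)
    (hZ4 : GoodOrdinaryRankZeroAtTwo ∧ MultiplicativeRankZeroAtTwo ∧ SupersingularRankZeroAtTwo ∧ AdditiveRankZeroAtTwo)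
    (hX : RankOneAtTwoBigImageOddLocal) :
    DoorIndexLawFullCAtTwoSomeDoorResidueSha ∧ DoorIndexLawFullCAtTwoSomeDoorResidueNonEgg :=
  residueSha_and_residueNonEgg_of_someDoor
    (doorIndexLawFullCAtTwoSomeDoor_of_rankOneAtTwoBigImageOddLocal hGZ hKo hnf hHL
      (fun V _ _ hVCM hV0 => bsdp_two_of_rankZero_cruxes hZ4 V hVCM hV0) hX)

end Summit.BirchSwinnertonDyer.BirchSwinnertonDyer.Theorems.RankOneAtTwoOneDoor

end
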